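import Summits.ABC.ABC.Theses.IsogenyGlueCongruence
import Literature.NumberTheory.EllipticCurves.CuspFormLFunction
import Literature.NumberTheory.EllipticCurves.IsogenyFaltingsLFunctionProofs
import Literature.NumberTheory.EllipticCurves.IsogenyFrobeniusTraceHoldsProofs
import Literature.NumberTheory.EllipticCurves.LFunctionCoefficientBound
import Literature.NumberTheory.EllipticCurves.RootNumberSmulProofs
import Summits.ABC.ABC.Theorems.IsogenyGlueCongruencePolyFreyMazurPairsStubSturmTwoLevel
import Summits.ABC.ABC.Theorems.IsogenyGlueCongruencePolyFreyMazurPairsStubTorsionTransportMinimal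
import Summits.ABC.ABC.Theorems.IsogenyGlueCongruencePolyFreyMazurPairsStubTraceCongruenceMinimal

/-!
# Polynomial Frey–Mazur for pairs, from modularity (crux `PolyFreyMazurPairs`, stmt-ABC-2047)

Route `IsogenyGlueCongruence`, crux `Summit.ABC.ABC.Theses.IsogenyGlueCongruence.PolyFreyMazurPairs`
(stmt-ABC-2047): *there are `κ, C` such that for all elliptic curves `W, W'/ℚ`, every prime `ℓ` with a
`Gal(ℚ̄/ℚ)`-equivariant isomorphism `W[ℓ] ≃+ W'[ℓ]` and `W`, `W'` not `ℚ`-isogenous satisfies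
`ℓ ≤ C · max(N_W, N_W')^κ`.*

REPAIR 2026-08-16 (fullbuild breakage "186:4: Unknown identifier", dependency drift). Route rev 18 of
`IsogenyGlueCongruence` (right-size, 2026-08-16T14:44Z) DROPPED the crux `PolyFreyMazurPairs` (stmt-ABC-2047,
closed as moot), so the gate-written `Theses/IsogenyGlueCongruence.lean` no longer declares
`Summit.ABC.ABC.Theses.IsogenyGlueCongruence.PolyFreyMazurPairs` while this Theorems file — append-only,
statement texts fixed — still names it in the headers of `polyFreyMazurPairs_of_distinguishingPrime` and
`polyFreyMazurPairs_of_exists_isNewformOf`. As in `Theorems/SwallowTheDatumTargetGlue.lean`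
(FinalStateConjecture, same situation), the dropped constant is RE-DECLARED below (§ 0) under its original
fully-qualified name with its original definiens (the item's ledger signature, verbatim), solely so that
the landed proof record keeps elaborating; every previously landed declaration is byte-identical. It is
NOT a route item and nothing in the tree takes it as a hypothesis.

This file is the sorry-free composition of the line `sturm-window-effective-smo` (tree
`Summits/ABC/ABC/Cruxes/PolyFreyMazurPairs/Lines/sturm_window_effective_smo.lean`, lead
prover-line-stmt-ABC-2047-0): it proves the crux with `κ = 6`, `C = 16` **conditionally on the Modularity
Theorem**, taken as the tree's named fact
`Literature.NumberTheory.EllipticCurves.ModularForms.exists_isNewformOf` (Wiles 1995, Taylor–Wiles 1995,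
Breuil–Conrad–Diamond–Taylor 2001 Thm A; level = conductor by Carayol 1986) — the ONE undischarged input;
everything else is proved in the tree with the standard axioms:

* **Galois half** (`traceCongruence`): an equivariant `W[ℓ] ≅ W'[ℓ]` forces
  `a_p(W) ≡ a_p(W') (mod ℓ)` at every prime `p ≠ ℓ` of good reduction for both — Serre 1981 (238) via
  the landed stubs `stub_traceCongruenceMinimal` (global minimal models: `trace_galoisRepTorsion_frobenius_eq`
  ×2 + `LinearMap.trace_conj'`) and `stub_torsionTransportMinimal` (passage to a global minimal model along
  the equivariant change-of-variables isomorphism), glued by the isomorphism invariance of `a_p` and `N`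
  (`LFunction_smul`, `conductorNorm_smul`);
* **Hasse pinch** (`lFunction_eq_of_hassePinch`): for `16 p < ℓ²` the congruence is an equality
  (`|a_p − a_p'| ≤ 4√p < ℓ`, from `abs_LFunction_prime_pow_le`);
* **modular half** (landed stub `stub_sturmTwoLevel`): newforms `f ∈ S₂(Γ₀(N))`, `g ∈ S₂(Γ₀(N'))` with the
  same `a_p` at the primes `p ∤ N N'`, `p ≤ (N N')³` have the same `a_n` at every `n` prime to `N N'`
  (sieve to level `L·rad L`, `L = N N'`, truncated two-level Hecke recursion, cuspidal Sturm bound);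
* **Faltings** (`isIsogenous_of_finite_setOf_LFunction_ne` + `isIsogenous_iff_frobeniusTrace_eq_holds`,
  PROVED in the tree along Bost's route): equal `a_p` off a finite set ⟹ `ℚ`-isogenous.

Composition (`polyFreyMazurPairs_of_exists_isNewformOf`): if `ℓ > 16·max(N,N')⁶` then `(N N')³ < ℓ` and
`16 < ℓ` (`window_lt_of_bound_lt`), so every prime `p ∤ N N'` with `p ≤ (N N')³` has `p ≠ ℓ` and `16p < ℓ²`,
whence `a_p(W) = a_p(W')` there; modularity gives the newforms, the Sturm stub spreads the equality to all
`p ∤ N N'`, and Faltings contradicts `¬ W.IsIsogenous W'`.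

HONEST STATUS. The theorem is CONDITIONAL (`proof.conditional` on `exists_isNewformOf`); it does not close
stmt-ABC-2047 by itself. It becomes unconditional by `polyFreyMazurPairs_of_exists_isNewformOf h` the day
`exists_isNewformOf` is discharged (or is filed as a route item `h`). Disproof.lean of the crux (cdisprove
cycle 1, NO KILL) is honoured: `¬ IsIsogenous` is consumed at the Faltings step, the equivariance of `e`
inside `traceCongruence`, small `ℓ` by `C = 16`.

References: Serre, Publ. Math. IHÉS 54 (1981) §8.1 (238); Sturm, LNM 1240 (1987) Thm 1; Diamond–Shurman,
GTM 228, Prop. 5.8.5, Thm 8.8.3; Faltings, Invent. Math. 73 (1983) §5 Kor. 2; Silverman AEC V.1.1, C.16;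
Kraus–Oesterlé, Math. Ann. 293 (1992) (the same Sturm-bound mechanism for a single pair).
-/

-- `Summit.<Summit>.<Problem>` is the mandated summit-side namespace (CONVENTIONS §2); for the
-- single-conjunct summit `ABC` the two coincide, so the duplicate `ABC.ABC` is deliberate.
set_option linter.dupNamespace false

noncomputable section

/-! ## § 0 Record of the dropped crux statement (route rev 18) -/

namespace Summit.ABC.ABC.Theses.IsogenyGlueCongruence

open scoped BigOperators Topology Manifold Classical MeasureTheory ProbabilityTheory Matrix InnerProductSpace ComplexConjugate ContinuousMap
open Filter Set Function TopologicalSpace MeasureTheory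

/-- **Record of the dropped crux `PolyFreyMazurPairs`** = stmt-ABC-2047 (ledger signature verbatim, in
the route file's namespace and `open` context; NOT a route item). *Polynomial Frey–Mazur for pairs:*
there are `κ, C : ℝ` such that for all elliptic curves `W, W'/ℚ` and every prime `ℓ`, a
`Gal(ℚ̄/ℚ)`-equivariant group isomorphism `W[ℓ] ≃+ W'[ℓ]` (`geomTorsion`) between curves that are not
`ℚ`-isogenous forces `ℓ ≤ C · max(N_W, N_{W'})^κ` (`conductorNorm ℤ`). The route dropped the item at
rev 18 (2026-08-16T14:44:06Z, right-size to the D-0019 caps; item closed as moot) after this file had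
landed (p87921) the conditional proof `polyFreyMazurPairs_of_exists_isNewformOf : exists_isNewformOf → …`
naming the constant, so the gate-written `Theses/IsogenyGlueCongruence.lean` no longer declares it while
this append-only file still names it ("Unknown identifier" in the full build of 2026-08-16T23:32Z).
Re-declared here under its original fully-qualified name and definiens solely so that the proof record
keeps elaborating. Status: PROVED BELOW CONDITIONALLY on the Modularity Theorem (`exists_isNewformOf`);
known in substance unconditionally (Gaudron–Rémond 2023 Thm 1.5(1)+1.8 at `E × E'` with von Känel's
bound `h(E) ≤ ¼ N (log N)² + 9`, see `Cruxes/PolyFreyMazurPairs/Disproof.lean`). -/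
def PolyFreyMazurPairs : Prop :=
  ∃ κ C : ℝ, ∀ (W W' : WeierstrassCurve ℚ) [W.IsElliptic] [W'.IsElliptic] (ℓ : ℕ), ℓ.Prime → (∃ e : W.geomTorsion ℓ ≃+ W'.geomTorsion ℓ, ∀ (σ : Field.absoluteGaloisGroup ℚ) (P : W.geomTorsion ℓ), e (σ • P) = σ • e P) → ¬ W.IsIsogenous W' → (ℓ : ℝ) ≤ C * (max (W.conductorNorm ℤ) (W'.conductorNorm ℤ) : ℝ) ^ κ

end Summit.ABC.ABC.Theses.IsogenyGlueCongruence

open scoped MatrixGroups ModularForm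

namespace Summit.ABC.ABC.Theorems.PolyFreyMazurPairs

open Literature.NumberTheory.EllipticCurves.ModularForms

/-! ## § 1 The Galois half for arbitrary models -/

/-- **A Galois-equivariant isomorphism of `ℓ`-torsion is a congruence of traces of Frobenius
(arbitrary models).** For elliptic `W, W'/ℚ`, a prime `ℓ`, a `Γ_ℚ`-equivariant group isomorphism
`e : W[ℓ] ≃+ W'[ℓ]` and a prime `p ≠ ℓ` not dividing `N_W N_{W'}`: `a_p(W) ≡ a_p(W') (mod ℓ)`.
From the global-minimal case (`stub_traceCongruenceMinimal`, Serre 1981 (238)) by transporting `e` along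
the equivariant torsion isomorphisms `W[ℓ] ≅ (C • W)[ℓ]`, `W'[ℓ] ≅ (C' • W')[ℓ]` of
`stub_torsionTransportMinimal`; `a_p` and the conductor are isomorphism invariants (`LFunction_smul`,
`conductorNorm_smul`). [cite: Serre1981, §8.1 eq. (238) (p. 188)] -/
theorem traceCongruence (W W' : WeierstrassCurve ℚ) [W.IsElliptic] [W'.IsElliptic] {ℓ : ℕ}
    (hℓ : ℓ.Prime) (e : W.geomTorsion ℓ ≃+ W'.geomTorsion ℓ)
    (he : ∀ (σ : Field.absoluteGaloisGroup ℚ) (P : W.geomTorsion ℓ), e (σ • P) = σ • e P)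
    {p : ℕ} (hp : p.Prime) (hpℓ : p ≠ ℓ) (hpNN : ¬ p ∣ W.conductorNorm ℤ * W'.conductorNorm ℤ) :
    ((W.LFunction p - W'.LFunction p : ℤ) : ZMod ℓ) = 0 := by
  obtain ⟨C, hC, eC, heC⟩ := stub_torsionTransportMinimal W ℓ hℓ
  obtain ⟨C', hC', eC', heC'⟩ := stub_torsionTransportMinimal W' ℓ hℓ
  haveI := hC
  haveI := hC'
  -- the transported isomorphism `(C • W)[ℓ] ≃+ (C' • W')[ℓ]` and its equivariance
  set e₀ : (C • W).geomTorsion ℓ ≃+ (C' • W').geomTorsion ℓ := eC.symm.trans (e.trans eC') with he₀def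
  have heCsymm : ∀ (σ : Field.absoluteGaloisGroup ℚ) (Q : (C • W).geomTorsion ℓ),
      eC.symm (σ • Q) = σ • eC.symm Q := fun σ Q ↦ by
    apply eC.injective
    rw [heC, AddEquiv.apply_symm_apply, AddEquiv.apply_symm_apply]
  have he₀ : ∀ (σ : Field.absoluteGaloisGroup ℚ) (Q : (C • W).geomTorsion ℓ),
      e₀ (σ • Q) = σ • e₀ Q := fun σ Q ↦ by
    simp only [he₀def, AddEquiv.trans_apply]
    rw [heCsymm, he, heC']
  have hN : (C • W).conductorNorm ℤ = W.conductorNorm ℤ := WeierstrassCurve.conductorNorm_smul ℤ W C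
  have hN' : (C' • W').conductorNorm ℤ = W'.conductorNorm ℤ :=
    WeierstrassCurve.conductorNorm_smul ℤ W' C'
  have key := stub_traceCongruenceMinimal (C • W) (C' • W') ℓ hℓ e₀ he₀ p hp hpℓ (by rwa [hN, hN'])
  rwa [WeierstrassCurve.LFunction_smul, WeierstrassCurve.LFunction_smul] at key

/-! ## § 2 The Hasse pinch and the window arithmetic -/

/-- **Hasse pinch.** If `a_p(W) ≡ a_p(W') (mod ℓ)` and `16 p < ℓ²`, then `a_p(W) = a_p(W')`: by Hasse
(`abs_LFunction_prime_pow_le`, PROVED) `|a_p(W) − a_p(W')| ≤ 4√p < ℓ`, and a non-zero multiple of `ℓ` has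
absolute value `≥ ℓ`. [folklore] -/
theorem lFunction_eq_of_hassePinch (W W' : WeierstrassCurve ℚ) [W.IsElliptic] [W'.IsElliptic]
    {p ℓ : ℕ} (hp : p.Prime) (h16 : 16 * p < ℓ ^ 2)
    (h : ((W.LFunction p - W'.LFunction p : ℤ) : ZMod ℓ) = 0) :
    W.LFunction p = W'.LFunction p := by
  have hdvd : (ℓ : ℤ) ∣ W.LFunction p - W'.LFunction p :=
    (ZMod.intCast_zmod_eq_zero_iff_dvd _ ℓ).mp h
  have hbound : ∀ (V : WeierstrassCurve ℚ) [V.IsElliptic], |(V.LFunction p : ℝ)| ≤ 2 * Real.sqrt p := by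
    intro V _
    have h1 := V.abs_LFunction_prime_pow_le hp 1
    rw [pow_one, pow_one] at h1
    have h2 : ((1 : ℕ) : ℝ) + 1 = 2 := by norm_num
    calc |(V.LFunction p : ℝ)| ≤ ((1 : ℕ) + 1) * Real.sqrt p := h1
      _ = 2 * Real.sqrt p := by rw [h2]
  by_contra hne
  have hd0 : W.LFunction p - W'.LFunction p ≠ 0 := sub_ne_zero.mpr hne
  have hle : (ℓ : ℤ) ≤ |W.LFunction p - W'.LFunction p| :=
    Int.le_of_dvd (abs_pos.mpr hd0) ((dvd_abs _ _).mpr hdvd)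
  have hR : (ℓ : ℝ) ≤ 4 * Real.sqrt p := by
    have h1 : ((ℓ : ℤ) : ℝ) ≤ ((|W.LFunction p - W'.LFunction p| : ℤ) : ℝ) := by exact_mod_cast hle
    rw [Int.cast_natCast, Int.cast_abs, Int.cast_sub] at h1
    calc (ℓ : ℝ) ≤ |(W.LFunction p : ℝ) - (W'.LFunction p : ℝ)| := h1
      _ ≤ |(W.LFunction p : ℝ)| + |(W'.LFunction p : ℝ)| := abs_sub _ _
      _ ≤ 2 * Real.sqrt p + 2 * Real.sqrt p := add_le_add (hbound W) (hbound W')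
      _ = 4 * Real.sqrt p := by ring
  have hp0 : (0 : ℝ) ≤ p := Nat.cast_nonneg p
  have hsq : ((ℓ ^ 2 : ℕ) : ℝ) ≤ ((16 * p : ℕ) : ℝ) := by
    push_cast
    calc (ℓ : ℝ) ^ 2 ≤ (4 * Real.sqrt p) ^ 2 := pow_le_pow_left₀ (Nat.cast_nonneg ℓ) hR 2
      _ = 16 * (Real.sqrt p) ^ 2 := by ring
      _ = 16 * p := by rw [Real.sq_sqrt hp0]
  have hle' : ℓ ^ 2 ≤ 16 * p := by exact_mod_cast hsq
  omega

/-- **Window arithmetic.** The negation of the crux's bound with `κ = 6`, `C = 16`, i.e.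
`16 · max(N, N')⁶ < ℓ` over `ℝ`, gives the two natural-number facts the window argument uses:
`(N N')³ < ℓ` (so every prime of the window is `≠ ℓ`) and `16 < ℓ` (so `16 p < ℓ²` there). [folklore] -/
theorem window_lt_of_bound_lt {N N' ℓ : ℕ} (hN : 0 < N)
    (h : 16 * (max (N : ℝ) (N' : ℝ)) ^ (6 : ℝ) < ℓ) :
    (N * N') ^ 3 < ℓ ∧ 16 < ℓ := by
  set M : ℝ := max (N : ℝ) (N' : ℝ) with hM
  have hM1 : 1 ≤ M := le_trans (by exact_mod_cast hN) (le_max_left _ _)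
  have hM0 : 0 ≤ M := zero_le_one.trans hM1
  have hpow : M ^ (6 : ℝ) = M ^ (6 : ℕ) := by
    rw [show (6 : ℝ) = ((6 : ℕ) : ℝ) by norm_num, Real.rpow_natCast]
  rw [hpow] at h
  have hM6 : 1 ≤ M ^ 6 := one_le_pow₀ hM1
  have hNM : (N : ℝ) ≤ M := le_max_left _ _
  have hN'M : (N' : ℝ) ≤ M := le_max_right _ _
  constructor
  · have h1 : (N : ℝ) * N' ≤ M ^ 2 := by
      rw [sq]
      exact mul_le_mul hNM hN'M (Nat.cast_nonneg N') hM0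
    have h2 : ((N : ℝ) * N') ^ 3 ≤ M ^ 6 := by
      calc ((N : ℝ) * N') ^ 3 ≤ (M ^ 2) ^ 3 := pow_le_pow_left₀ (by positivity) h1 3
        _ = M ^ 6 := by ring
    have h3 : (((N * N') ^ 3 : ℕ) : ℝ) < ℓ := by
      push_cast
      nlinarith [h2, h, hM6]
    exact_mod_cast h3
  · have h4 : (16 : ℝ) < ℓ := lt_of_le_of_lt (by nlinarith [hM6]) h
    exact_mod_cast h4

/-! ## § 3 The unconditional reduction: the crux from a polynomial distinguishing prime -/

/-- **Polynomial Frey–Mazur for pairs from a polynomially small distinguishing prime (UNCONDITIONAL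
reduction).** Suppose that any two non-`ℚ`-isogenous elliptic curves `W, W'/ℚ` are distinguished by a
good prime of the window: some prime `p ∤ N_W N_{W'}` with `p ≤ (N_W N_{W'})³` and `a_p(W) ≠ a_p(W')`
("effective multiplicity one for elliptic curves", in print a consequence of modularity + the Sturm
bound: `distinguishingPrime_of_exists_isNewformOf` below; also of GRH via Chebotarev, Serre 1981 §8.3).
Then the crux `PolyFreyMazurPairs` holds with `κ = 6`, `C = 16`: for `ℓ > 16 · max(N, N')⁶` the
distinguishing prime `p` has `p ≤ (N N')³ < ℓ`, so `p ≠ ℓ` and `16 p < ℓ²`; the Galois half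
(`traceCongruence`, Serre (238)) gives `ℓ ∣ a_p(W) − a_p(W')` and the Hasse pinch
(`lFunction_eq_of_hassePinch`) forces `a_p(W) = a_p(W')` — contradiction. No modular form, height or
isogeny estimate enters this step. [cite: Serre1981, §8.1 eq. (238) (p. 188)] -/
theorem polyFreyMazurPairs_of_distinguishingPrime
    (hsep : ∀ (W W' : WeierstrassCurve ℚ) [W.IsElliptic] [W'.IsElliptic], ¬ W.IsIsogenous W' →
      ∃ p : ℕ, p.Prime ∧ ¬ p ∣ W.conductorNorm ℤ * W'.conductorNorm ℤ ∧
        p ≤ (W.conductorNorm ℤ * W'.conductorNorm ℤ) ^ 3 ∧ W.LFunction p ≠ W'.LFunction p) :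
    Summit.ABC.ABC.Theses.IsogenyGlueCongruence.PolyFreyMazurPairs := by
  refine ⟨6, 16, ?_⟩
  intro W W' _ _ ℓ hℓ hex hniso
  obtain ⟨e, he⟩ := hex
  have hN : 0 < W.conductorNorm ℤ := WeierstrassCurve.conductorNorm_pos_holds W
  by_contra hlt
  rw [not_le] at hlt
  obtain ⟨hL3, h16⟩ := window_lt_of_bound_lt (N' := W'.conductorNorm ℤ) hN hlt
  obtain ⟨p, hp, hpNN, hpB, hne⟩ := hsep W W' hniso
  have hpℓ : p < ℓ := lt_of_le_of_lt hpB hL3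
  have h16p : 16 * p < ℓ ^ 2 := by
    calc 16 * p < 16 * ℓ := by omega
      _ ≤ ℓ * ℓ := Nat.mul_le_mul_right ℓ h16.le
      _ = ℓ ^ 2 := (sq ℓ).symm
  exact hne (lFunction_eq_of_hassePinch W W' hp h16p (traceCongruence W W' hℓ e he hp hpℓ.ne hpNN))

/-! ## § 4 The modular input: a distinguishing prime in the window, from modularity -/

/-- **Effective multiplicity one for elliptic curves over `ℚ`, from the Modularity Theorem.** Assuming
modularity as the tree's named fact `exists_isNewformOf` (every elliptic `W/ℚ` has a newform
`f ∈ S₂(Γ₀(N_W))` with `aₙ(f) = aₙ(W)`; Breuil–Conrad–Diamond–Taylor 2001 Thm A): two elliptic curves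
`W, W'/ℚ` that are not `ℚ`-isogenous are distinguished by some prime `p ∤ N N'`, `p ≤ (N N')³`, i.e.
`a_p(W) ≠ a_p(W')`. Proof: otherwise the newforms `f`, `f'` of `W`, `W'` agree at all primes `p ∤ N N'` of
the window, hence (landed stub `stub_sturmTwoLevel`: sieve to level `L·rad L`, `L = N N'`, truncated
two-level Hecke recursion, cuspidal Sturm bound) at every index prime to `N N'`, so `a_p(W) = a_p(W')` for
all `p ∤ N N'` and Faltings' isogeny theorem (`isIsogenous_of_finite_setOf_LFunction_ne` with
`isIsogenous_iff_frobeniusTrace_eq_holds`, PROVED in the tree) makes `W ~ W'`. Sturm 1987 Thm 1;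
Kraus–Oesterlé 1992 (same mechanism). [cite: BreuilConradDiamondTaylor2001, Thm. A] [cite: Sturm1987, Thm. 1] -/
theorem distinguishingPrime_of_exists_isNewformOf (hmod : exists_isNewformOf)
    (W W' : WeierstrassCurve ℚ) [W.IsElliptic] [W'.IsElliptic] (hniso : ¬ W.IsIsogenous W') :
    ∃ p : ℕ, p.Prime ∧ ¬ p ∣ W.conductorNorm ℤ * W'.conductorNorm ℤ ∧
      p ≤ (W.conductorNorm ℤ * W'.conductorNorm ℤ) ^ 3 ∧ W.LFunction p ≠ W'.LFunction p := by
  have hN : 0 < W.conductorNorm ℤ := WeierstrassCurve.conductorNorm_pos_holds W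
  have hN' : 0 < W'.conductorNorm ℤ := WeierstrassCurve.conductorNorm_pos_holds W'
  haveI : NeZero (W.conductorNorm ℤ) := ⟨hN.ne'⟩
  haveI : NeZero (W'.conductorNorm ℤ) := ⟨hN'.ne'⟩
  by_contra hsep
  push Not at hsep
  -- the newforms of `W` and `W'` (modularity)
  obtain ⟨f, hf⟩ := hmod W
  obtain ⟨f', hf'⟩ := hmod W'
  -- two-level Sturm: equality of all coefficients prime to `N N'`
  have hcoeff : ∀ n : ℕ, n.Coprime (W.conductorNorm ℤ * W'.conductorNorm ℤ) →
      cuspCoeff f n = cuspCoeff f' n :=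
    stub_sturmTwoLevel (W.conductorNorm ℤ) (W'.conductorNorm ℤ) f f' hf.1 hf'.1
      (fun p hp hpNN hpB ↦ by rw [hf.2 p, hf'.2 p, hsep p hp hpNN hpB])
  -- Faltings (proved in the tree): `a_p` agree off the prime factors of `N N'`, so `W ~ W'`
  have hfin : {p : ℕ | p.Prime ∧ W.LFunction p ≠ W'.LFunction p}.Finite := by
    refine (W.conductorNorm ℤ * W'.conductorNorm ℤ).primeFactors.finite_toSet.subset ?_
    rintro p ⟨hp, hne⟩
    refine (Nat.mem_primeFactors_of_ne_zero (mul_ne_zero hN.ne' hN'.ne')).mpr ⟨hp, ?_⟩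
    by_contra hpNN
    apply hne
    have key := hcoeff p ((Nat.Prime.coprime_iff_not_dvd hp).mpr hpNN)
    rw [hf.2 p, hf'.2 p] at key
    exact_mod_cast key
  exact hniso (WeierstrassCurve.isIsogenous_of_finite_setOf_LFunction_ne
    WeierstrassCurve.isIsogenous_iff_frobeniusTrace_eq_holds W W' hfin)

/-! ## § 5 The composition -/

/-- **Polynomial Frey–Mazur for pairs, from the Modularity Theorem** (crux `PolyFreyMazurPairs` of route
`IsogenyGlueCongruence`, stmt-ABC-2047, with `κ = 6`, `C = 16`): assuming modularity in the form of the
tree's named fact `exists_isNewformOf` (Breuil–Conrad–Diamond–Taylor 2001 Thm A), for all elliptic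
`W, W'/ℚ` and every prime `ℓ` carrying a `Gal(ℚ̄/ℚ)`-equivariant isomorphism `W[ℓ] ≃+ W'[ℓ]` with `W`, `W'`
not `ℚ`-isogenous, `ℓ ≤ 16 · max(N_W, N_{W'})⁶` — `polyFreyMazurPairs_of_distinguishingPrime` fed with
`distinguishingPrime_of_exists_isNewformOf`. CONDITIONAL on `exists_isNewformOf` and on nothing else
(Serre's trace congruence, the Sturm bound, the sieve and Faltings' isogeny theorem are theorems of the
tree). In print: Kraus–Oesterlé 1992 / Serre 1987 §4 give this kind of bound for a fixed pair; the
polynomial dependence on the conductors is the point here. [cite: BreuilConradDiamondTaylor2001, Thm. A] -/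
theorem polyFreyMazurPairs_of_exists_isNewformOf (hmod : exists_isNewformOf) :
    Summit.ABC.ABC.Theses.IsogenyGlueCongruence.PolyFreyMazurPairs :=
  polyFreyMazurPairs_of_distinguishingPrime
    (fun W W' _ _ hniso ↦ distinguishingPrime_of_exists_isNewformOf hmod W W' hniso)

/-! ## § 6 What holds unconditionally: finiteness of the congruence primes of a fixed pair -/

/-- **Frey–Mazur finiteness for a fixed pair (UNCONDITIONAL in the tree).** Two elliptic curves `W, W'/ℚ`
that are not `ℚ`-isogenous share their `ℓ`-torsion Galois module (`W[ℓ] ≃+ W'[ℓ]` equivariantly) for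
only finitely many primes `ℓ`. Proof: by Faltings' isogeny theorem (PROVED in the tree,
`isIsogenous_of_finite_setOf_LFunction_ne`) infinitely many primes `p` have `a_p(W) ≠ a_p(W')`, so some
such `p₀` is prime to `N N'`; every congruence prime `ℓ ≠ p₀` divides `a_{p₀}(W) − a_{p₀}(W') ≠ 0`
(`traceCongruence`, Serre (238)), whence `ℓ ≤ |a_{p₀}(W) − a_{p₀}(W')|`. The crux asks for this bound
to be POLYNOMIAL in `max(N, N')`, which is where the distinguishing prime must be made effective (§ 3–4).
[cite: Serre1981, §8.1 eq. (238) (p. 188)] -/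
theorem finite_setOf_torsionCongruencePrime (W W' : WeierstrassCurve ℚ) [W.IsElliptic] [W'.IsElliptic]
    (hniso : ¬ W.IsIsogenous W') :
    {ℓ : ℕ | ℓ.Prime ∧ ∃ e : W.geomTorsion ℓ ≃+ W'.geomTorsion ℓ,
      ∀ (σ : Field.absoluteGaloisGroup ℚ) (P : W.geomTorsion ℓ), e (σ • P) = σ • e P}.Finite := by
  have hN : 0 < W.conductorNorm ℤ := WeierstrassCurve.conductorNorm_pos_holds W
  have hN' : 0 < W'.conductorNorm ℤ := WeierstrassCurve.conductorNorm_pos_holds W'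
  -- a good prime `p₀` with `a_{p₀}(W) ≠ a_{p₀}(W')` (Faltings)
  have hinf : {p : ℕ | p.Prime ∧ W.LFunction p ≠ W'.LFunction p}.Infinite := fun hfin ↦
    hniso (WeierstrassCurve.isIsogenous_of_finite_setOf_LFunction_ne
      WeierstrassCurve.isIsogenous_iff_frobeniusTrace_eq_holds W W' hfin)
  obtain ⟨p₀, ⟨hp₀, hne⟩, hp₀NN⟩ := (hinf.sdiff
    (W.conductorNorm ℤ * W'.conductorNorm ℤ).primeFactors.finite_toSet).nonempty
  have hp₀NN' : ¬ p₀ ∣ W.conductorNorm ℤ * W'.conductorNorm ℤ := fun h ↦ hp₀NN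
    ((Nat.mem_primeFactors_of_ne_zero (mul_ne_zero hN.ne' hN'.ne')).mpr ⟨hp₀, h⟩)
  -- every congruence prime `ℓ ≠ p₀` divides the non-zero integer `a_{p₀}(W) - a_{p₀}(W')`
  set d : ℤ := W.LFunction p₀ - W'.LFunction p₀ with hd
  have hd0 : d ≠ 0 := sub_ne_zero.mpr hne
  refine ((Finset.range (d.natAbs + 1) ∪ {p₀}).finite_toSet).subset ?_
  rintro ℓ ⟨hℓ, e, he⟩
  simp only [Finset.coe_union, Finset.coe_singleton, Set.mem_union, Finset.mem_coe, Finset.mem_range,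
    Set.mem_singleton_iff]
  by_cases hℓp : ℓ = p₀
  · exact Or.inr hℓp
  · left
    have hcong := traceCongruence W W' hℓ e he hp₀ (Ne.symm hℓp) hp₀NN'
    have hdvd : (ℓ : ℤ) ∣ d := (ZMod.intCast_zmod_eq_zero_iff_dvd _ ℓ).mp hcong
    have hle : ℓ ≤ d.natAbs := Nat.le_of_dvd (Int.natAbs_pos.mpr hd0) (Int.natAbs_dvd_natAbs.mpr hdvd)
    omega

end Summit.ABC.ABC.Theorems.PolyFreyMazurPairs

end
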